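import Summits.ValiantsHypothesis.ValiantsHypothesis.Theses.MonotoneRestoration

/-!
# `MonotoneRestoration.MonotoneRestorationQP` (stmt-ValiantsHypothesis-15886) — negative side: load-bearing hypotheses

Standing disprover (cdisprove, cycle 1), from `Cruxes/MonotoneRestorationQP/Disproof.lean` §(a).
Any proof of the crux — quasi-polynomial square-symmetric circuits over `ℂ` for every
matrix-symmetric family in `ℝ≥0[x_ij]` of polynomial degree and polynomial MONOTONE complexity —
must use

* the MONOTONE-COMPLEXITY bound: `monotoneRestorationQP_false_without_complexity` — with only
  matrix symmetry and polynomial degree the statement fails at the nonnegative permanent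
  (`perPoly (Fin n) ℝ≥0`: matrix-symmetric, degree `n`), by Dawar–Wilsenach 2025 Thm 7.1
  (`DawarWilsenach2025_thm71_holds`, proved in the tree) and `2^((log₂ n + c)^c) < 2^(δ n)`;
* the INVARIANCE hypothesis: `monotoneRestorationQP_false_without_invariance` — a square-symmetric
  circuit computes a diagonally invariant polynomial (`IsSymmetric.rename_eval_output_unit`), and
  the single variable `x₀₁` (degree `1`, monotone complexity `0`) is not diagonally invariant.

The refuted VARIANTS are inlined in the two `¬ (…)` statements (inner block = the crux's,
verbatim, with one hypothesis deleted); the witnesses (`perPoly`, `x₀₁`) are inlined. No facts.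
[folklore]
-/

set_option linter.dupNamespace false

namespace Summit.ValiantsHypothesis.ValiantsHypothesis.Theorems.MonotoneRestorationQP.Negative

open Literature.Computability.AlgebraicComplexity MvPolynomial

noncomputable section

/-- The arithmetic of the route's deciding theorem: `(log₂ n + c)^c < δ n` for all large `n`.
[folklore] -/
theorem polylog_pow_lt_linear (c : ℕ) {δ : ℝ} (hδ : 0 < δ) :
    ∃ n₀ : ℕ, ∀ n : ℕ, n₀ ≤ n → ((Nat.log 2 n + c) ^ c : ℝ) < δ * n := by
  have hlim : Filter.Tendsto (fun k : ℕ => (k : ℝ) ^ c / (2 : ℝ) ^ k) Filter.atTop (nhds 0) :=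
    tendsto_pow_const_div_const_pow_of_one_lt c one_lt_two
  have hδ' : 0 < δ / 2 ^ c := by positivity
  obtain ⟨k₁, hk₁⟩ := Filter.eventually_atTop.1 (hlim.eventually (gt_mem_nhds hδ'))
  refine ⟨2 ^ max k₁ c, fun n hn => ?_⟩
  set k₀ : ℕ := max k₁ c with hk₀def
  have hn0 : n ≠ 0 := by
    have : 0 < 2 ^ k₀ := Nat.two_pow_pos _
    omega
  set k := Nat.log 2 n with hkdef
  have hk : k₀ ≤ k := by
    rw [hkdef]
    calc k₀ = Nat.log 2 (2 ^ k₀) := (Nat.log_pow Nat.one_lt_two _).symm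
      _ ≤ Nat.log 2 n := Nat.log_mono_right hn
  have hkc : c ≤ k := le_trans (le_max_right _ _) hk
  have hk1 : k₁ ≤ k := le_trans (le_max_left _ _) hk
  have hA : ((k + c) ^ c : ℝ) ≤ (2 : ℝ) ^ c * (k : ℝ) ^ c := by
    have : (k + c : ℝ) ≤ 2 * k := by
      have : (c : ℝ) ≤ k := by exact_mod_cast hkc
      linarith
    calc ((k + c) ^ c : ℝ) ≤ (2 * (k : ℝ)) ^ c := by
          exact pow_le_pow_left₀ (by positivity) this c
      _ = (2 : ℝ) ^ c * (k : ℝ) ^ c := by rw [mul_pow]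
  have hB : (k : ℝ) ^ c < δ / 2 ^ c * (2 : ℝ) ^ k := by
    have h := hk₁ k hk1
    have h2k : (0 : ℝ) < (2 : ℝ) ^ k := by positivity
    rwa [div_lt_iff₀ h2k] at h
  have hC : ((2 : ℝ) ^ k : ℝ) ≤ n := by
    have := Nat.pow_log_le_self 2 hn0
    rw [← hkdef] at this
    exact_mod_cast this
  have h2c : (0 : ℝ) < (2 : ℝ) ^ c := by positivity
  calc ((Nat.log 2 n + c) ^ c : ℝ) = ((k + c) ^ c : ℝ) := by rw [hkdef]
    _ ≤ (2 : ℝ) ^ c * (k : ℝ) ^ c := hA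
    _ < (2 : ℝ) ^ c * (δ / 2 ^ c * (2 : ℝ) ^ k) := by
        exact mul_lt_mul_of_pos_left hB h2c
    _ = δ * (2 : ℝ) ^ k := by field_simp
    _ ≤ δ * n := by exact mul_le_mul_of_nonneg_left hC hδ.le

/-- **The conclusion of the crux fails at the permanent**: the nonnegative permanent has no
square-symmetric circuits over `ℂ` of size `2^((log₂ n + c)^c)` (Dawar–Wilsenach 2025, Thm 7.1,
size form — a theorem of the tree). -/
theorem not_qpSymmetric_perPoly :
    ¬ ∃ c : ℕ, ∀ n : ℕ, ∃ (G : Type) (_ : Fintype G)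
        (C : LabelledArithCircuit ℂ (Fin n × Fin n) Unit G),
        C.IsSymmetric (Equiv.Perm (Fin n)) ∧
          C.eval (C.output ()) = MvPolynomial.map (Complex.ofRealHom.comp NNReal.toRealHom)
            (perPoly (Fin n) NNReal) ∧
          Fintype.card G ≤ 2 ^ ((Nat.log 2 n + c) ^ c) := by
  rintro ⟨c, hc⟩
  classical
  choose G inst C hCsymm hCeval hCcard using hc
  have hper : ∀ n, (C n).eval ((C n).output ()) = perPoly (Fin n) ℂ := fun n => by
    rw [hCeval n]; exact map_perPoly _
  obtain ⟨δ, hδ, hio⟩ :=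
    @DawarWilsenach2025_thm71.size_form DawarWilsenach2025_thm71_holds ℂ _ _ G inst C hCsymm hper
  obtain ⟨n₀, key⟩ := polylog_pow_lt_linear c hδ
  obtain ⟨n, hn, hle⟩ := hio n₀
  have hcard : (Fintype.card (G n) : ℝ) ≤ (2 : ℝ) ^ (((Nat.log 2 n + c) ^ c : ℕ) : ℝ) := by
    rw [Real.rpow_natCast]
    exact_mod_cast hCcard n
  have hlt : (2 : ℝ) ^ (((Nat.log 2 n + c) ^ c : ℕ) : ℝ) < (2 : ℝ) ^ (δ * n) := by
    apply (Real.rpow_lt_rpow_left_iff one_lt_two).2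
    have := key n hn
    push_cast at this ⊢
    exact this
  exact absurd (hle.trans hcard) (not_le.mpr hlt)

/-- The nonnegative permanent is matrix-symmetric (any commutative semiring). [folklore] -/
theorem rename_perm_perPoly (n : ℕ) (σ τ : Equiv.Perm (Fin n)) :
    MvPolynomial.rename (fun p : Fin n × Fin n => (σ p.1, τ p.2)) (perPoly (Fin n) NNReal) =
      perPoly (Fin n) NNReal := by
  have h1 : MvPolynomial.rename (fun p : Fin n × Fin n => (σ p.1, τ p.2))
      (perPoly (Fin n) NNReal) =
      ((Matrix.mvPolynomialX (Fin n) (Fin n) NNReal).submatrix σ τ).permanent := by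
    simp only [perPoly, Matrix.permanent, map_sum, map_prod, Matrix.mvPolynomialX_apply,
      MvPolynomial.rename_X, Matrix.submatrix_apply]
  rw [h1]
  have h2 : ((Matrix.mvPolynomialX (Fin n) (Fin n) NNReal).submatrix (σ : Fin n → Fin n)
      (τ : Fin n → Fin n)) =
      (((Matrix.mvPolynomialX (Fin n) (Fin n) NNReal).submatrix id (τ : Fin n → Fin n)).submatrix
        (σ : Fin n → Fin n) id) := by
    ext i j; simp
  rw [h2, Matrix.permanent_permute_cols, Matrix.permanent_permute_rows]
  rfl

/-- **(a1) Any proof of `MonotoneRestorationQP` must use the monotone-complexity bound**: the crux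
with the clause `complexity (k := ℝ≥0) (f n) ≤ (n + 2) ^ c` deleted (degree bound kept) is FALSE —
witness the nonnegative permanent (Dawar–Wilsenach 2025, Thm 7.1). -/
theorem monotoneRestorationQP_false_without_complexity :
    ¬ ∀ f : (n : ℕ) → MvPolynomial (Fin n × Fin n) NNReal,
      (∀ (n : ℕ) (σ τ : Equiv.Perm (Fin n)),
        MvPolynomial.rename (fun p : Fin n × Fin n => (σ p.1, τ p.2)) (f n) = f n) →
      (∃ c : ℕ, ∀ n : ℕ, (f n).totalDegree ≤ (n + 2) ^ c) →
      ∃ c : ℕ, ∀ n : ℕ, ∃ (G : Type) (_ : Fintype G)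
        (C : LabelledArithCircuit ℂ (Fin n × Fin n) Unit G),
        C.IsSymmetric (Equiv.Perm (Fin n)) ∧
          C.eval (C.output ()) = MvPolynomial.map (Complex.ofRealHom.comp NNReal.toRealHom) (f n) ∧
          Fintype.card G ≤ 2 ^ ((Nat.log 2 n + c) ^ c) := by
  intro h
  refine not_qpSymmetric_perPoly (h (fun n => perPoly (Fin n) NNReal) rename_perm_perPoly ⟨1, ?_⟩)
  intro n
  calc (perPoly (Fin n) NNReal).totalDegree ≤ Fintype.card (Fin n) :=
        perPoly_isHomogeneous.totalDegree_le
    _ ≤ (n + 2) ^ 1 := by simp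

/-- **(a2) Any proof of `MonotoneRestorationQP` must use the invariance hypothesis**: the crux with
the matrix-symmetry hypothesis deleted is FALSE — a square-symmetric circuit computes a polynomial
invariant under the diagonal action `x_ij ↦ x_{σ i, σ j}`, and `x₀₁` (degree `1`, monotone
complexity `0`) is moved by the transposition `(0 1)`. (The conclusion needs only DIAGONAL
invariance; the crux assumes the larger group `S_n × S_n` — that weakening is open, see
`Cruxes/MonotoneRestorationQP/Disproof.lean`, `MonotoneRestorationQPDiag`.) -/
theorem monotoneRestorationQP_false_without_invariance :
    ¬ ∀ f : (n : ℕ) → MvPolynomial (Fin n × Fin n) NNReal,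
      (∃ c : ℕ, ∀ n : ℕ, (f n).totalDegree ≤ (n + 2) ^ c ∧
        complexity (k := NNReal) (f n) ≤ (n + 2) ^ c) →
      ∃ c : ℕ, ∀ n : ℕ, ∃ (G : Type) (_ : Fintype G)
        (C : LabelledArithCircuit ℂ (Fin n × Fin n) Unit G),
        C.IsSymmetric (Equiv.Perm (Fin n)) ∧
          C.eval (C.output ()) = MvPolynomial.map (Complex.ofRealHom.comp NNReal.toRealHom) (f n) ∧
          Fintype.card G ≤ 2 ^ ((Nat.log 2 n + c) ^ c) := by
  intro h
  -- the witness: the off-diagonal variable `x₀₁` (and `0` below `n = 2`)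
  set offDiag : (n : ℕ) → MvPolynomial (Fin n × Fin n) NNReal :=
    fun n => if h : 2 ≤ n then X (⟨0, by omega⟩, ⟨1, by omega⟩) else 0 with hoffDiag
  have offDiag_two : offDiag 2 = X ((0 : Fin 2), (1 : Fin 2)) := by
    simp [hoffDiag]
  have hmono : ∃ c : ℕ, ∀ n : ℕ, (offDiag n).totalDegree ≤ (n + 2) ^ c ∧
      complexity (k := NNReal) (offDiag n) ≤ (n + 2) ^ c := by
    refine ⟨1, fun n => ?_⟩
    simp only [hoffDiag]
    split_ifs with h2
    · constructor
      · exact (totalDegree_X _).le.trans (by simp)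
      · rw [complexity_X_holds]; exact Nat.zero_le _
    · constructor
      · simp
      · have : complexity (k := NNReal) (0 : MvPolynomial (Fin n × Fin n) NNReal) = 0 := by
          simpa using complexity_C_holds (σ := Fin n × Fin n) (0 : NNReal)
        rw [this]; exact Nat.zero_le _
  obtain ⟨c, hc⟩ := h offDiag hmono
  obtain ⟨G, _, C, hsymm, heval, -⟩ := hc 2
  have key := hsymm.rename_eval_output_unit (Equiv.swap (0 : Fin 2) 1)
  rw [heval, offDiag_two, map_X, rename_X] at key
  have hinj := MvPolynomial.X_injective (σ := Fin 2 × Fin 2) (R := ℂ) key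
  simp [Prod.ext_iff] at hinj

end

end Summit.ValiantsHypothesis.ValiantsHypothesis.Theorems.MonotoneRestorationQP.Negative
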